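import Mathlib
import HarnessLib
import HarnessLib.Audit
import Summits.BirchSwinnertonDyer.Statement
import Summits.BirchSwinnertonDyer.Rank1Residual.SmallImageMu.KatoDivisibilityEdges
import Summits.BirchSwinnertonDyer.BirchSwinnertonDyer.Theorems.SignedLowerHalvesRealPeriodUnitPlusPeriod
import Summits.BirchSwinnertonDyer.BirchSwinnertonDyer.Theorems.InputsGreenbergCharValueRankZeroByName
import Summits.BirchSwinnertonDyer.BirchSwinnertonDyer.Theorems.Rank1ResidualX9Defs
import HarnessLib.Audit.Status.Attr

/-!
Route: OneSidedTwistSqueezeX9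

# Route OneSidedTwistSqueezeX9 — one-sided tau-free Kato divisibility on X9 squeezes rung K6 through
printed BCS (5.3)

It suffices to show X = KatoDivisibilityX9 ∧ SchneiderX9RankOne on the class X9 (non-CM, good
ordinary p ≥ 5, E[p] irreducible,
ρ̄_{E,p} NOT surjective; tree class `Rank1Residual.ClassX9`): (K) for every X9 pair (E, p), all
cyclotomic data, every newform f of E
and every Selmer dual datum D, the p-adic L-function L_p(f, α_p) lies in ι(char_Λ X(E/ℚ_∞)) — Kato's
divisibility ONE-SIDED,
INTEGRAL, with neither the image hypothesis (im) nor a Kolyvagin element τ (tree node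
`SmallImageMu.KatoDivisibilityOnClassX9`, by
name); (Sch) Schneider non-degeneracy at the rank-1 X9 pairs (item stmt-BirchSwinnertonDyer-19631,
shared). With the PRINTED integral
FOUR-fold product inequality (5.3) of Burungale–Castella–Skinner 2025 (E and its quadratic twists by
d_K, d_F, d_K·d_F of their Lemma 5.2.3; support Display53X9, cite-only) and the rung's
published-input bundle (support
PublishedInputsX9 = stmt-19632, shared) the landed kernel theorem
`SmallImageMu.bsdpOnClassX9_of_katoDivisibility_squeeze` (p537308) gives
the rung-K6 leaf BSDpOnClassX9. Realises card one-sided-kato-four-twist-squeeze-x9 (spine). No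
analytic μ = 0 statement (19630) is used.
Lean: `Summit.BirchSwinnertonDyer.Rank1Residual.SmallImageMu.KatoDivisibilityOnClassX9 ∧ (∀ (W :
WeierstrassCurve ℚ) [W.IsElliptic] [W.IsGloballyMinimal] (p : ℕ) [Fact p.Prime],
Summit.BirchSwinnertonDyer.BirchSwinnertonDyer.Rank1Residual.ClassX9 W p → W.analyticRank = 1 → ∀ Dh
: WeierstrassCurve.PAdicHeightData W p, Dh.IsCanonical → WeierstrassCurve.SchneiderConjecture Dh)`

## Assembly
The deciding theorem is `closes (hAsm : Assembly) hC1 h53 hPub hC3 := hAsm hC1 h53 hPub hC3` (every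
declared item load-bearing, BC6, as on route SmallImageMuTransfer); the Assembly item is CLOSED
(stmt-BirchSwinnertonDyer-20549, proved by
`Summit.BirchSwinnertonDyer.Rank1Residual.SmallImageMu.oneSidedTwistSqueezeX9_assembly_proof`,
Theorems/OneSidedTwistSqueezeX9Assembly.lean — one application of the landed kernel theorem
`Summit.BirchSwinnertonDyer.Rank1Residual.SmallImageMu.bsdpOnClassX9_of_katoDivisibility_squeeze`,
p537308, axioms propext/Classical.choice/Quot.sound): KatoDivisibilityX9 → Display53X9 →
PublishedInputsX9 → SchneiderX9RankOne → BSDpOnClassX9.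
Inside it (`integralMainConjectureOnClassX9_of_katoDivisibility_squeeze`): take the admissible
discriminants d_K < 0 < d_F that (5.3) supplies (Lemma 5.2.3:
d_K a square and d_F a non-square mod p, (d_K·d_F, pN) = 1); the globally minimal models of E^{d_K},
E^{d_F}, E^{d_K d_F} are again X9 pairs at p
(`X9.classX9_of_smul_eq_quadraticTwist`); apply the crux FOUR times (kᵢ ≤ 0), BCS Thm 1.1.2 (a) at
the four curves, the four-fold (5.3) and Rohrlich non-vanishing
squeeze k = 0 for E: the integral main conjecture for E, then the K6 leaf by the rung's standard
rank-0 / rank-1 readings.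

CLOSES_TARGET: closes rung K6 of BirchSwinnertonDyer: Summit.BirchSwinnertonDyer.BirchSwinnertonDyer.Rank1Residual.BSDpOnClassX9 (D-0061; not the summit Statement) — the deciding theorem of this route concludes that registered leaf instead of the Statement decl `BirchSwinnertonDyer` (class rung: servable and labelled, never counted as concluding the summit Statement).

Rationale: WHY THIS LINE. Kato's two-sided theorem 17.4(3) (Kato2004Asterisque) and its base-change upgrade
BurungaleCastellaSkinner2025 Thm 1.1.2 (b) need τ ∈ im ρ with
coker(τ − 1) free of rank one, which is impossible at every level on X9 (p ∤ #im ρ̄), but BCS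
display (5.3) — the FOUR-fold product divisibility
ch X(E)·ch X(E^{d_K})·ch X(E^{d_F})·ch X(E^{d_K d_F}) ⊆ (L_p(E)·L_p(E^{d_K})·L_p(E^{d_F})·L_p(E^{d_K
d_F})) in Λ, for the auxiliary discriminants d_K < 0 < d_F of
their Lemma 5.2.3 (prime to pN) — is integral under irreducibility ALONE (arXiv:2405.00270 p.10),
and the three quadratic twists of an X9 pair by d_K, d_F, d_K·d_F
are again X9 pairs (tree `X9.TwistStability`). So ONE one-sided inequality per X9 pair, applied to E
and to its three twists, squeezes equality: the open content is exactly the Kolyvagin-side sign of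
the μ-defect k = μ(X) − μ(L_p) ≤ 0, independent of
the Greenberg-side statement μ(L_p) = 0 that routes SmallImageMuTransfer (item 19630) and PrintX9
carry. Imported areas: Euler/Kolyvagin systems
(the crux), two-variable Iwasawa theory over K specialised to the cyclotomic line (the printed
(5.3)), p-adic heights (Schneider, shared
rider). The negatives index (TamePinch, stmt-15532) is not touched: nothing here quantifies ∃ p over
curves.

RANKED CRUXES. #2 KatoDivisibilityX9 (crux) — for every X9 pair (W, p), every cyclotomic
ℤ_p-extension κ with topological generator γ (cyclotomic variable), every newform f of W and every
Selmer dual datum D: ∃ g ∈ D.charIdeal with ι g = L_p(f, unitRoot W p) — one-sided τ-free Kato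
divisibility (card K1; tree node by name; exponent reading k ≤ 0 via
`SmallImageMu.katoDivisibilityOnClassX9_iff_muDefectNonpos`). [difficulty: open-problem] (why it
might fail: an X9 pair with μ(L_p) ≥ 1 whose Selmer μ is strictly larger (k ≥ 1): without τ the
Euler-system index is bounded only up to a p-power, and no printed argument excludes such a pair
(Greenberg Conj 1.11 predicts none).) [Kato2004Asterisque, BurungaleCastellaSkinner2025,
Wuthrich2006, arXiv:2405.00270]
#3 SchneiderX9RankOne (crux) — for every X9 pair of analytic rank 1 and every canonical p-adic
height datum, Schneider's non-degeneracy conjecture holds (item stmt-BirchSwinnertonDyer-19631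
verbatim; shared with route SmallImageMuTransfer, staffed once). [difficulty: open-problem] (why it
might fail: Schneider's conjecture is open; one rank-1 X9 pair with p-adic regulator 0 (cyclotomic
height degenerate on E(ℚ) ⊗ ℚ_p) breaks it — certified nonzero only pair by pair.) [Schneider1985,
MazurRubin2004, DeoRaySujatha2023]
#9 Display53X9 (support) — Burungale–Castella–Skinner 2025 display (5.3): for E/ℚ, p ≥ 5 good
ordinary, E[p] irreducible, and an admissible imaginary quadratic K, ch_Λ(X(E))·ch_Λ(X(E^K)) ⊆
(L_p(E)·L_p(E^K)) INTEGRALLY in Λ (cite-only named fact, by name; never staffed, closes when the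
fact becomes a theorem). [difficulty: XL] [BurungaleCastellaSkinner2025, arXiv:2405.00270]
#9 PublishedInputsX9 (support) — the published-input bundle of rung K6 (item
stmt-BirchSwinnertonDyer-19632 verbatim; shared): BCS Thm 1.1.2 (a) ∧ Greenberg rank-0 value ∧
period unit ∧ Schneider 1985 order ∧ Perrin-Riou rank-1 leading terms ∧ modular parametrisation ∧
entire L-function ∧ rank = analytic rank ≤ 1. [difficulty: XL] [BurungaleCastellaSkinner2025,
GreenbergVatsal2000, Schneider1985]

TWO-LAYER PLAN. BIRTH SKELETON REGISTERED (2026-08-27T19:15:06Z, `Lines/birth.lean` attached as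
evidence on stmt-BirchSwinnertonDyer-20547, skeleton sha
8dc060a26a11a443; `ledger crux write` is reserved to item-named seats): stub_conjAOnClassX9
(`SmallImageMu.ConjAOnClassX9`, hardest, open-problem grade) ·
stub_wuthrichUpgradeX9 (`ConjAOnClassX9 → KatoDivisibilityX9`, the tribunal's T3 PLAN-ONLY witness;
kernel-checked in the file = stub_muDefectLeFineMuOnClassX9
(S-W⁺ on X9, `Rank1Residual.MuDefectLeFineMuAt`) + BCS (a) + BCDT + F1-fine via the landed edge
`SmallImageMu.katoDivisibilityOnClassX9_of_conjAOnClassX9'`) ·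
stub_fmwRungX9 (the BC5 rung's exact signature: at an X9 pair with
`Rank1Residual.RankOneAnchorDataAt` and S-W⁺, `KatoDivisibilityAt`; proved in
HOME/imc/g4/OneSidedTwistSqueezeX9FMWRung.landing.lean 2a4f5150bddaa2bb, landing pending) ·
`KatoDivisibilityX9_of` proved. No item split is filed (the crux stays ONE
item; stubs are not items). The foreseen split, if a line is later promoted: (m3) ConjAOnClassX9
(Coates–Sujatha Conjecture A at (ℚ, E, p) for
X9 pairs; tree `FineSelmer.CoatesSujathaConjectureA` restricted) → WuthrichUpgradeX9 (ClassX9 → Conj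
A at the pair → KatoDivisibilityAt; Wuthrich
2006 Thm 2/4 re-run image-free with the tame-image dictionary) → KatoDivisibilityX9; alternative
(m1) bi-level rank-two Kolyvagin induction
(index-drop lemma at composite level) as a LINE on the same crux, not a second split.

KILL CRITERIA. Refutation of KatoDivisibilityX9 — ONE X9 pair with μ(L_p) ≥ 1 and k ≥ 1 (Selmer μ
computed larger) — closes the route refuted:KatoDivisibilityX9
(and settles Greenberg 1.11 negatively on X9). Refutation of SchneiderX9RankOne at one rank-1 pair
kills only the rank-1 conjunct: pivot = restate the
leaf's rank-1 half per pair (certificates) exactly as SmallImageMuTransfer would. Mooted if item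
19630 (AnalyticMuZeroX9) is PROVED class-wide
(then SmallImageMuTransfer closes K6; close superseded) or if IntegralMainConjectureOnClassX9 lands
by any other road.

NOT DECOMPOSED YET. The mechanism for k ≤ 0 without τ is deliberately not decomposed at open: three
candidate lines are on record with their walls ((m1) missing
index-drop lemma; (m2) Hida-family constancy of k needs two-variable two-sided control = (ram),
absent on X9; (m3) Conjecture A), and the crux
chain (crux-ideate → triage → crux-plan) should choose. The per-pair regime split (μ_an = 0: already
a theorem mod F1; μ_an ≥ 1: the whole open
content) is a reading, not an item.

CHEAPEST FALSIFIER. On the census (k6fin dde28b2c4045f536, 790 X9 r ≤ 1 pairs; wave B1 272/272): a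
certified row with dim_𝔽p Sel_p(E/ℚ) > λ_an, or λ_an < r + dim Ш[p]_an
— ran (HOME/es/falsifier_c1.py, < 1 CPU-s): 0 violations / 790; 14/14 rows with p² ∣ #Ш_an have λ_an
= r + 2 exactly; rows with μ_an ≥ 1: 0/790.
Next: the v1 table's MU-POSITIVE list (expected empty) and a `sel_p_rank` column.

NUMBERS. X9 census: 790 r ≤ 1 pairs = 130 5Ns + 36 7Ns + 624 5S4 (+ 58 r ≥ 2 in the v1 inputs =
848); μ_an = 0 certified two-engine 790/790; wave B1
(PARI) μ = 0 on 272/272 pairs with N ≤ 20 000; [ℚ(P):ℚ] ∈ {8, 12, 24} on X9; 0/849 surjective-image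
congruent partners (theorem); CM partners 91/790.

DEFINITION REQUESTS. None: every notion is in the tree (ClassX9, SelmerDualData.charIdeal,
iwasawaToPowerSeries, padicLFunction, unitRoot, PAdicHeightData.IsCanonical,
SchneiderConjecture, the BCS (5.3) fact, the leaf BSDpOnClassX9).

BIRTH CERTIFICATE (record; opened 2026-08-27T15:05:56Z by -imc g2, tribunal PASS round 1, operator
replay 18:40:16Z, J tier B R4.25/A2.5/L4/B4/K3.25; refreshed by
-imc g6). bc1 cone = 2 open load-bearing cruxes / 5 binders (Assembly closed) — pass. bc2 C → S
probes FAILED 2/2 (BC7 P5; no landed `C → S` / `S ↔ C`); S → C: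
not closed (KatoDivisibilityX9 is Λ-adic and rank-free; SchneiderX9RankOne open). bc3 skeletons 1:
KatoDivisibilityX9 `Lines/birth.lean` (4 stubs, sorries = stubs,
per-stub probes stubᵢ → C / stubᵢ → leaf FAILED 8/8); SchneiderX9RankOne is the shared item 19631
(lines on SmallImageMuTransfer). bc4 dedup clean 2/2 (`exact?`
fails; negatives index TamePinch stmt-15532 / HorizontalIndivisibilityOnClassX9 unrelated). bc5:
KatoDivisibilityX9: PLAN-ONLY stub_wuthrichUpgradeX9 :
ConjAOnClassX9 → KatoDivisibilityX9 via Wuthrich 2006 Thm 2 / Lemma 3 re-run image-free with Kato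
§17.13 at (p) — why C not S: Λ-adic, every analytic rank, no
height; the landable RUNG is stub_fmwRungX9 (anchored X9 pairs, 234/415 rank-1 census records,
instance 648a1 @ 5 outside every printed case of the crux and of
the leaf) — witness upgrades to `SmallImageMu.katoDivisibilityAt_of_rankOneAnchorData` when it
lands. bc6: declared 5 / in-cone 5 / aside 0 (+ 8 asides by
dedup, rev 1). bc7: 3/3 CLEAN. bc8: 2/2 placed (KatoDivisibilityX9: PAdicHeight — outside;
EisensteinMu — outside its locus; HeegnerPoint — crux rank-free, leaf
inside by design; the uncatalogued τ / big-image wall [corpus:paper:arxiv-2405.00270 p.10]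
[corpus:paper:doi-10-4310-mrl-2006-v13-n5-a3 p.717] — requires
beating it, how: the line is ONE-sided and routes the p-power loss into μ(X₀); SchneiderX9RankOne:
PAdicHeight(Narrow) — IS it, declared). bc9: method_family =
euler-systems kato-divisibility quadratic-twist-squeeze cyclotomic-iwasawa-main-conjecture
padic-heights; ladder_ceiling = capped-at-«divisibility up to a
p-power» (τ-free Kato: char X ∣ p^t·L_p); ceiling_lift = fine-Selmer μ = 0 (Conj A, line m3) or an
index-drop lemma at bi-level rank-two primes (m1) — declared-crux:
KatoDivisibilityX9; ceiling_sources = [Kato2004Asterisque Thm 13.4/17.4;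
corpus:paper:arxiv-2405.00270 p.10; corpus:paper:doi-10-4310-mrl-2006-v13-n5-a3 p.717;
galaxy: no relevant hits for "one divisibility|Kato's divisibility|without surjectivity" --star
all]. tk (gate kernel of record 15:13:56Z) = PROVISIONAL
[carrier-unverified ×2, t1c-timeout, witness-unverified, barrier-unmatched] → all resolved by the
seats (final: judge_recommend pass, fail_grounds []).
tribunal_fit persisted (J designate): residual [], witness = the registered stub_wuthrichUpgradeX9
(plan-only), s_case none, method_family as bc9.

Novelty: Searches (2026-08-27): lit search --hybrid "Kato divisibility main conjecture non-surjective image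
mu-invariant quadratic twist" -n 8 → 8 docs, nearest [corpus:paper:arxiv-2405.00270 pp.2,5,7],
[corpus:book:delbourgo2008-elliptic-curves-big-galois-representations p.326] (survey); lit vsearch
"p-adic L-function lies in the characteristic ideal … without assuming surjective" -k 8 → textbooks
only (Hida 2000, Lang, Cornell–Silverman–Stevens); lit galaxy search "one divisibility|Kato's
divisibility|without surjectivity" --star all -n 8 → 13 rows, 0 relevant
([galaxy:pdf:3128778390317373040] KLZ Rankin–Eisenstein, not this); cell pass REF2-LITMAP M1–M15 (22
rows, corpus + galaxy, 08-27); card searches MEMO-imc §6.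
Nearest prior art found: Wuthrich2006 Prop 7 [corpus:paper:doi-10-4310-mrl-2006-v13-n5-a3 p.717]
(Kato divisibility for non-surjective image CONDITIONAL on classical μ = 0 of an imaginary field, p
= 7 or p > 13); BurungaleCastellaSkinner2025 Thm 1.1.2 + (5.3)/(5.4) [corpus:paper:arxiv-2405.00270
p.10] (equality in Λ[1/p] under (irr); integral (5.4) only under (im)); Kato2004Asterisque Thm
17.4(3) (surjective); route SmallImageMuTransfer (μ-transfer + analytic μ = 0) and route PrintX9
(Heegner divisibility + analytic μ = 0) in the tree.
Delta: the first X9 thesis with NO analytic μ = 0 input — it isolates the one-sided τ-free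
divisibility (k ≤ 0) as the single open node and uses the printed INTEGRAL (5.3) plus X9 twist
stability to squeeze equality, a reduction kernel-cer  [refs: paper:arxiv-2405.00270, book:delbourgo2008-elliptic-curves-big-galois-representations, paper:doi-10-4310-mrl-2006-v13-n5-a3, Wuthrich2006, BurungaleCastellaSkinner2025]

Barriers (technique_class: euler-systems, iwasawa-main-conjecture, quadratic-twist): - technique_class: euler-systems, iwasawa-main-conjecture, quadratic-twist, padic-heights
- Literature.Barriers.BirchSwinnertonDyer.PAdicHeightBarrier: not evaded — crux SchneiderX9RankOne
IS it at the rank-1 pairs (shared item 19631, declared); KatoDivisibilityX9 and the squeeze are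
height-free.
- Literature.Barriers.BirchSwinnertonDyer.PAdicHeightBarrierNarrow: same, declared; bet: per-pair
height certificates as on the census.
- Literature.Barriers.BirchSwinnertonDyer.EisensteinMuBarrier: outside its locus — it quantifies
over curves with a ramified-odd rational LINE in E[p] (reducible); every X9 pair has E[p]
irreducible and no isogeny is crossed.
- Literature.Barriers.BirchSwinnertonDyer.HeegnerPointBarrier: inside by design (the leaf is rank ≤
1); nothing is claimed in rank ≥ 2; the crux itself is rank-free (a Λ-divisibility).
- Literature.Barriers.BirchSwinnertonDyer.HeegnerPointBarrierNarrow: inside likewise; no rank ≥ 2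
claim.
- Literature.Barriers.BirchSwinnertonDyer.AnticyclotomicHeightDegeneracy: evaded — the imaginary
quadratic K enters only through the printed cyclotomic-line inequality (5.3); no anticyclotomic
height or anticyclotomic main conjecture is an item.
- Literature.Barriers.BirchSwinnertonDyer.ExceptionalZeroBarrier: out of scope — good ordinary p ≥
5, no split-multiplicative trivial zero.
- Literature.Barriers.BirchSwinnertonDyer.ExceptionalZeroBarrierNarrow: out of scope likewise — it
blocks only identities that read the Mazur–Tate–Teitelbaum functi

History (route lifecycle, newest last):
- 2026-08-27T19:20:20Z · rev 2: informal re-worded for Display53X9 (planner-bsd-f3-mu-imc-g6-0)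

sub-problem: BirchSwinnertonDyer · status: open · opened planner-bsd-f3-mu-imc-g2-0 2026-08-27T15:05:56Z · rev 3 · ledger route-BirchSwinnertonDyer-OneSidedTwistSqueezeX9
GENERATED by the gate from the ledger (D-0016/17). Provers cite these decls: `theorem foo : Summit.BirchSwinnertonDyer.BirchSwinnertonDyer.Theses.OneSidedTwistSqueezeX9.<Decl> := …` in Summits/BirchSwinnertonDyer/BirchSwinnertonDyer/Theorems/<Name>.lean.
-/

namespace Summit.BirchSwinnertonDyer.BirchSwinnertonDyer.Theses.OneSidedTwistSqueezeX9

open scoped BigOperators Topology Manifold Classical MeasureTheory ProbabilityTheory Matrix InnerProductSpace ComplexConjugate ContinuousMap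
open Filter Set Function TopologicalSpace MeasureTheory

attribute [summit_statement] _root_.BirchSwinnertonDyer
attribute [summit_statement] _root_.Summit.BirchSwinnertonDyer.BirchSwinnertonDyer.Rank1Residual.BSDpOnClassX9

open Literature

/-- item stmt-BirchSwinnertonDyer-20547 · crux · rank 2 · open · by planner
why it might fail: an X9 pair with μ(L_p) ≥ 1 whose Selmer μ is strictly larger (k ≥ 1): without τ the Euler-system index is bounded only up to a p-power, and no printed argument excludes such a pair (Greenberg Conj 1.11 predicts none).
sources: Kato2004Asterisque, BurungaleCastellaSkinner2025, Wuthrich2006, arXiv:2405.00270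
[crux] for every X9 pair (W, p), every cyclotomic ℤ_p-extension κ with topological generator γ
(cyclotomic variable), every newform f of W and every Selmer dual datum D: ∃ g ∈ D.charIdeal with ι
g = L_p(f, unitRoot W p) — one-sided τ-free Kato divisibility (card K1; tree node by name; exponent
reading k ≤ 0 via `SmallImageMu.katoDivisibilityOnClassX9_iff_muDefectNonpos`). [difficulty:
open-problem] -/
@[route_item "route-BirchSwinnertonDyer-OneSidedTwistSqueezeX9", crux]
def KatoDivisibilityX9 : Prop :=
  Summit.BirchSwinnertonDyer.Rank1Residual.SmallImageMu.KatoDivisibilityOnClassX9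

/-- item stmt-BirchSwinnertonDyer-19631 · crux · rank 3 · open · by planner
why it might fail: Schneider's conjecture is open; one rank-1 X9 pair with p-adic regulator 0 (cyclotomic height degenerate on E(ℚ) ⊗ ℚ_p) breaks it — certified nonzero only pair by pair.
sources: Schneider1985, MazurRubin2004, DeoRaySujatha2023
[crux] Schneider's conjecture on the rank-1 part of X9: for every X9 pair (E, p) of analytic rank 1
and every CANONICAL p-adic height datum Dh on E at p, the cyclotomic p-adic height pairing is
non-degenerate (Reg_p ≠ 0) — the binder hC3 of the kernel bridge; by Perrin-Riou's p-adic
Gross–Zagier it is equivalent to ord_T L_p(f, α, T) = 1 on these pairs. [difficulty: L] -/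
@[route_item "route-BirchSwinnertonDyer-OneSidedTwistSqueezeX9", crux]
def SchneiderX9RankOne : Prop :=
  ∀ (W : WeierstrassCurve ℚ) [W.IsElliptic] [W.IsGloballyMinimal] (p : ℕ) [Fact p.Prime], Summit.BirchSwinnertonDyer.BirchSwinnertonDyer.Rank1Residual.ClassX9 W p → W.analyticRank = 1 → ∀ Dh : WeierstrassCurve.PAdicHeightData W p, Dh.IsCanonical → WeierstrassCurve.SchneiderConjecture Dh

/-- item stmt-BirchSwinnertonDyer-19266 · aside · rank 9 · open · by planner
sources: BCDTJAMS2001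
[support] modularity of E/ℚ as parametrisation data (Breuil–Conrad–Diamond–Taylor 2001 Thm A), BY
NAME — conjunct of OrdPublishedInputsAtTwo (19149; Literature.Uncategorized.OrdPublishedInputsAtTwo
l.26); same content, filed so the head constant is item-stated (#15c one rule; cite_only dep) -/
@[route_item "route-BirchSwinnertonDyer-OneSidedTwistSqueezeX9"]
def ModularParametrizationSupply : Prop :=
  Literature.NumberTheory.EllipticCurves.ModularForms.nonempty_modularParametrizationData

/-- item stmt-BirchSwinnertonDyer-19273 · aside · rank 9 · open · by planner
sources: BCDTJAMS2001, Wiles1995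
[support] entire continuation of L(E/ℚ, s) (modularity: Breuil–Conrad–Diamond–Taylor 2001 Thm A +
Hecke/Shimura), BY NAME — conjunct of MultConversePublishedInputsAtTwo (19185); same content, filed
so the head constant is item-stated (#15c one rule; cite_only dep) -/
@[route_item "route-BirchSwinnertonDyer-OneSidedTwistSqueezeX9"]
def EntireLFunctionRat : Prop :=
  WeierstrassCurve.hasEntireLFunction_rat

/-- item stmt-BirchSwinnertonDyer-19290 · aside · rank 9 · closed · proved by Summit.BirchSwinnertonDyer.BirchSwinnertonDyer.Theorems.SignedLowerHalves.RealPeriodUnitPlusPeriod_proof (prover) · by operator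
sources: GreenbergVatsal2000, AbbesUllmo1996
[support] Néron period vs. plus period of the newform: Ω_E = u · Ω⁺_f with u a p-adic unit, p ≥ 5
(Manin constant: Mazur 1978 Cor. 4.1, Edixhoven 1991 Prop. 2, Abbes–Ullmo 1996 Thm. A;
Greenberg–Vatsal 2000 Rem. 3.4) — conjunct of PublishedSignedInputs
(stmt-BirchSwinnertonDyer-19005), BY NAME; same content, filed as a split child so the head constant
is item-stated (gate5 #15c one rule; readiness rule 2026-08-15: cite_only dep declared by the
route); no statement / closes / tribunal change -/
@[route_item "route-BirchSwinnertonDyer-OneSidedTwistSqueezeX9"]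
def RealPeriodUnitPlusPeriod : Prop :=
  Literature.NumberTheory.EllipticCurves.realPeriodRat_eq_unit_mul_plusPeriod

/-- `RealPeriodUnitPlusPeriod` holds: proved by `Summit.BirchSwinnertonDyer.BirchSwinnertonDyer.Theorems.SignedLowerHalves.RealPeriodUnitPlusPeriod_proof`. -/
theorem RealPeriodUnitPlusPeriod_holds : RealPeriodUnitPlusPeriod := _root_.Summit.BirchSwinnertonDyer.BirchSwinnertonDyer.Theorems.SignedLowerHalves.RealPeriodUnitPlusPeriod_proof

/-- item stmt-BirchSwinnertonDyer-19459 · aside · rank 9 · open · by planner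
sources: BurungaleCastellaSkinner2025, arXiv:2405.00270
[support, cite-only] Burungale–Castella–Skinner 2025 Thm 1.1.2 (a) (arXiv:2405.00270v2 p. 2): for
E/ℚ, p ≥ 5 good ordinary with E[p] irreducible, the cyclotomic characteristic ideal equals (L_p(E))
in Λ ⊗ ℚ_p (integrally given μ = 0 on both sides) — conjunct of PublishedInputsX9
(stmt-BirchSwinnertonDyer-19632, text FROZEN REF v8-3), BY NAME; same content, filed as a split
child so the head constant is item-stated (readiness rule 2026-08-15 / gate5 #15c: a cite_only dep
must be declared by the route); no crux statement / closes / tribunal change; never staffed for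
proof (cite-only, to be HELD), closes only when the named fact becomes a theorem -/
@[route_item "route-BirchSwinnertonDyer-OneSidedTwistSqueezeX9"]
def BCSCharIdealEqPadicLFunction : Prop :=
  Literature.NumberTheory.EllipticCurves.burungale_castella_skinner_charIdeal_eq_padicLFunction

/-- item stmt-BirchSwinnertonDyer-19460 · aside · rank 9 · closed · proved by Summit.BirchSwinnertonDyer.BirchSwinnertonDyer.Theorems.InputsDeskTwoTurnkey.smallImageMuTransfer_greenbergCharValueRankZero (prover) · by planner
sources: GreenbergLNM1716
[support, cite-only] Greenberg LNM 1716 Thm 4.1 (p. 102; held copy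
book:coatesnd-arithmetic-theory-elliptic-curves chunk p0091): the rank-0 Euler-characteristic
formula f_E(0) ~ #Sel · ∏c_v · #Ẽ(𝔽_p)² / #E(ℚ)_tors² at good ordinary p — conjunct of
PublishedInputsX9 (stmt-BirchSwinnertonDyer-19632, text FROZEN REF v8-3), BY NAME; same content,
filed as a split child so the head constant is item-stated (readiness rule 2026-08-15 / gate5 #15c:
a cite_only dep must be declared by the route); no crux statement / closes / tribunal change; never
staffed for proof (cite-only, to be HELD), closes only when the named fact becomes a theorem -/
@[route_item "route-BirchSwinnertonDyer-OneSidedTwistSqueezeX9"]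
def GreenbergCharValueRankZero : Prop :=
  Literature.NumberTheory.EllipticCurves.greenberg_charValue_rankZero

/-- `GreenbergCharValueRankZero` holds: proved by `Summit.BirchSwinnertonDyer.BirchSwinnertonDyer.Theorems.InputsDeskTwoTurnkey.smallImageMuTransfer_greenbergCharValueRankZero`. -/
theorem GreenbergCharValueRankZero_holds : GreenbergCharValueRankZero := _root_.Summit.BirchSwinnertonDyer.BirchSwinnertonDyer.Theorems.InputsDeskTwoTurnkey.smallImageMuTransfer_greenbergCharValueRankZero

/-- item stmt-BirchSwinnertonDyer-19468 · aside · rank 9 · open · by planner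
sources: Schneider1985, BalakrishnanMullerStein2015
[aside] Schneider 1985 Thm 2′ (p. 342) / Thm 7 (p. 371) with Perrin-Riou 1992 §3.4.2–3.4.3
(transcribed from Balakrishnan–Müller–Stein 2015 Thm 1.7): ord_T of a characteristic generator =
rank and its leading term up to a unit, given Schneider's non-degeneracy — conjunct 4 of
PublishedInputsX9, inside the split child IwasawaLeadingTermFactsX9; item-stated BY NAME here
because split.k_max = 7 from this seat forced two facts into one child. Banked context (aside):
never staffed; no crux statement / closes / tribunal change. -/
@[route_item "route-BirchSwinnertonDyer-OneSidedTwistSqueezeX9"]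
def SchneiderOrderCharGenerator : Prop :=
  Literature.NumberTheory.EllipticCurves.Schneider1985_order_charGenerator

/-- item stmt-BirchSwinnertonDyer-19469 · aside · rank 9 · open · by planner
sources: PerrinRiou1987
[aside] Perrin-Riou 1987 Thm 1.3, (1.1) and §1.4 Cor. 1.8 (p-adic Gross–Zagier): rank-one leading
terms — conjunct 5 of PublishedInputsX9, inside the split child IwasawaLeadingTermFactsX9;
item-stated BY NAME here because split.k_max = 7 from this seat forced two facts into one child.
Banked context (aside): never staffed; no crux statement / closes / tribunal change. -/
@[route_item "route-BirchSwinnertonDyer-OneSidedTwistSqueezeX9"]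
def PerrinRiouRankOneLeadingTerms : Prop :=
  Literature.NumberTheory.EllipticCurves.perrinRiou_rankOne_leadingTerms

/-- item stmt-BirchSwinnertonDyer-19632 · support · rank 9 · open · by planner
sources: BurungaleCastellaSkinner2025, GreenbergVatsal2000, Schneider1985
[support] The eight PUBLISHED named facts the kernel bridge `bsdpOnClassX9_of_katoMuTransfer`
consumes, as one conjunction of the tree's cited Props: BCS 2025 Thm 1.1.2 (a) (characteristic ideal
= (L_p) given μ = 0 and Kato), Greenberg 1999 Thm 4.1 (rank-0 Euler characteristic), the real period
vs plus period unit relation, Schneider 1985 (order of the characteristic power series), Perrin-Riou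
1987 rank-one leading terms, modularity (parametrisation), entire L-function over ℚ, rank = analytic
rank ≤ 1 (Gross–Zagier–Kolyvagin). Provable-now means: discharge conjunct by conjunct as the
`_holds` theorems land; the non-`_odd` Schneider/Perrin-Riou facts are the bridge's exact binder
types. [difficulty: provable-now] -/
@[route_item "route-BirchSwinnertonDyer-OneSidedTwistSqueezeX9", crux]
def PublishedInputsX9 : Prop :=
  Literature.NumberTheory.EllipticCurves.burungale_castella_skinner_charIdeal_eq_padicLFunction ∧ Literature.NumberTheory.EllipticCurves.greenberg_charValue_rankZero ∧ Literature.NumberTheory.EllipticCurves.realPeriodRat_eq_unit_mul_plusPeriod ∧ Literature.NumberTheory.EllipticCurves.Schneider1985_order_charGenerator ∧ Literature.NumberTheory.EllipticCurves.perrinRiou_rankOne_leadingTerms ∧ Literature.NumberTheory.EllipticCurves.ModularForms.nonempty_modularParametrizationData ∧ WeierstrassCurve.hasEntireLFunction_rat ∧ Literature.NumberTheory.EllipticCurves.rank_eq_analyticRank_of_analyticRank_le_one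

/-- item stmt-BirchSwinnertonDyer-19921 · aside · rank 9 · open · by operator
sources: GrossZagier1986, KolyvaginEulerSystems1990
[support] The one PUBLISHED input the halves-glue consumes: Gross–Zagier–Kolyvagin, rank = analytic
rank for analytic rank ≤ 1 with Ш finite (tree named fact
rank_eq_analyticRank_of_analyticRank_le_one; used by bsdp_of_missingPPartAt to turn Miller's last
clause into BSD(E,2)). Carried as a displayed PUB hypothesis; never counted as progress. The further
PRINT of the roads to the two halves (Greenberg Thm-4.1 analogues at a multiplicative prime
thm41Analogue_charValue_rankZero_numberField_anyPrime / …_split_baseChange_anyPrime, modularity) and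
the referee-passed MEMO inputs (Kato ⊗ℚ at a multiplicative 2:
X5.O1.KatoMultiplicativeDivisibilityRat W 2, HOME mult/PROOF-MULT.md RC-2; Greenberg–Stevens at 2:
greenberg_stevens W 2, mult/PROOF-GS2.md RC-4) enter the LINES under the halves (bridge
multiplicativeRankZeroAtTwo_of_muRoad, p409679), not this glue. -/
@[route_item "route-BirchSwinnertonDyer-OneSidedTwistSqueezeX9"]
def RankEqAnalyticRankLeOne : Prop :=
  Literature.NumberTheory.EllipticCurves.rank_eq_analyticRank_of_analyticRank_le_one

/-- item stmt-BirchSwinnertonDyer-20548 · support · rank 9 · open · by planner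
sources: BurungaleCastellaSkinner2025, arXiv:2405.00270
[support, cite-only] Burungale–Castella–Skinner 2025, display (5.3) with Lemma 5.2.3 (p. 10 of
arXiv:2405.00270v2) — the FOUR-fold product divisibility: for E/ℚ, p ≥ 5 good ordinary, E[p]
irreducible, all cyclotomic data (κ, γ) and every newform f of E, there are fundamental
discriminants d_K < 0 < d_F (d_K a square and d_F a non-square mod p, (d_K·d_F, pN) = 1) such that
for the globally minimal models E₁, E₂, E₃ of the quadratic twists E^{d_K}, E^{d_F}, E^{d_K d_F},
all their newforms, Mazur–Swinnerton-Dyer period ratios ϖᵢ and all Selmer dual data: ch_Λ X(E)·ch_Λ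
X(E₁)·ch_Λ X(E₂)·ch_Λ X(E₃) ⊆ (G) INTEGRALLY in Λ with ι G = ∏ᵢ ϖᵢ·L_p(fᵢ, αᵢ). Tree fact
`Literature.NumberTheory.EllipticCurves.BurungaleCastellaSkinner2025.display53_prod_charIdeal_le_prod_padicLFunction`
BY NAME (never staffed; closes when the fact becomes a theorem). -/
@[route_item "route-BirchSwinnertonDyer-OneSidedTwistSqueezeX9", crux]
def Display53X9 : Prop :=
  Literature.NumberTheory.EllipticCurves.BurungaleCastellaSkinner2025.display53_prod_charIdeal_le_prod_padicLFunction

/-- item stmt-BirchSwinnertonDyer-20549 · assembly · rank 1 · closed · proved by Summit.BirchSwinnertonDyer.Rank1Residual.SmallImageMu.oneSidedTwistSqueezeX9_assembly_proof (prover) · by planner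
sources: BurungaleCastellaSkinner2025
[assembly] KatoDivisibilityX9 → Display53X9 → PublishedInputsX9 → SchneiderX9RankOne → the rung-K6
leaf BSDpOnClassX9. -/
@[route_item "route-BirchSwinnertonDyer-OneSidedTwistSqueezeX9", crux]
def Assembly : Prop :=
  KatoDivisibilityX9 → Display53X9 → PublishedInputsX9 → SchneiderX9RankOne → Summit.BirchSwinnertonDyer.BirchSwinnertonDyer.Rank1Residual.BSDpOnClassX9

-- `Assembly` holds: proved by `Summit.BirchSwinnertonDyer.Rank1Residual.SmallImageMu.oneSidedTwistSqueezeX9_assembly_proof` (its module imports this route file, so no `_holds` link can be stated here).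

/-! D-0027 §2.1 — DECIDING THEOREM (planner-authored via `route open/edit --closes-file`; by planner-bsd-f3-mu-imc-g2-0 2026-08-27T15:05:56Z):
its hypotheses are this route's items and its conclusion the registered leaf `Summit.BirchSwinnertonDyer.BirchSwinnertonDyer.Rank1Residual.BSDpOnClassX9` (rung K6, D-0061) (glue_lint), and it elaborates with this file. -/

@[closes "route-BirchSwinnertonDyer-OneSidedTwistSqueezeX9"] theorem closes (hAsm : Assembly) (hC1 : KatoDivisibilityX9) (h53 : Display53X9)
    (hPub : PublishedInputsX9) (hC3 : SchneiderX9RankOne) :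
    Summit.BirchSwinnertonDyer.BirchSwinnertonDyer.Rank1Residual.BSDpOnClassX9 :=
  -- `Assembly` (KatoDivisibilityX9 → Display53X9 → PublishedInputsX9 → SchneiderX9RankOne → leaf) is
  -- an item, proved on the Theorems side by one application of the landed squeeze
  -- `Summit.BirchSwinnertonDyer.Rank1Residual.SmallImageMu.bsdpOnClassX9_of_katoDivisibility_squeeze`
  -- (p537308); the deciding theorem is its application, so every declared item is load-bearing (BC6).
  hAsm hC1 h53 hPub hC3

end Summit.BirchSwinnertonDyer.BirchSwinnertonDyer.Theses.OneSidedTwistSqueezeX9
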